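/-
Origin: expansion seat `planner-pub-hodgecm-prl1-0`, handover v7 2026-08-18T03:52:31Z (`HOME/pub-hodgecm-prl1/lean/Prl1/VirtualCupJoin.lean`, md5 ccbd8a34, 62 lines);
landed by the gen-5 packager in gate run 20 as `HodgeCM/Automorphic/VirtualCupJoin.lean` (import ^import Prl1\.HeckeWedge\b→import HodgeCM.Automorphic.HeckeWedge ×1).
-/
/-
Copyright (c) 2026. All rights reserved.
Released under Apache 2.0 license as described in the file LICENSE.
-/
import Summits.HodgeConjecture.HodgeCM.Automorphic.HeckeWedge
import Summits.HodgeConjecture.HodgeCM.StubTree.RealisationReduction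

/-!
# One print fact for both realisation strategies (join prl1 ↔ prl2)

Venkataramana, *Cohomology of compact locally symmetric spaces*, Compositio Math. **125** (2001), Theorem 8
(p. 229): "Let `G(ℝ) = SU(n,1)` up to compact factors. Let `a, a′` be non-zero cohomology classes of degrees
`k, k′` in `H(Sh⁰G)` with `k + k′ ≤ n`. Then there exists a `g ∈ Ḡ_f` such that `g(a) ∧ a′ ≠ 0`."  It is
transcribed to the tower primitives twice in this package, with the same guard `4 ≤ [L:ℚ]` (compact quotients):

* prover 1 (`HodgeCM.Automorphic.HeckeWedge`): `ThetaModel.Fact_virtualCup Hk` — the two witnessing morphisms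
  are REMEMBERED as the covering `T.cover Γ Γ′ h` and a Hecke-translated covering `g ∈ Hk.tr Γ Γ′` (needed to keep
  theta one-forms theta one-forms, `Open_heckeTheta` = N33b);
* prover 2 (`HodgeCM.StubTree.RealisationReduction`): `Universe.Fact_virtualCup11` — the witnesses are two
  arbitrary morphisms `f g : P_{Γ′} → P_Γ` of the universe.

`virtualCup11_of_virtualCup` : the first implies the second (forget that the witnesses are coverings), so ONE
FACTS.md row — the typed reading `Fact_virtualCup` — serves both `Assembly.COR_CM_hecke` (prover 1) and
`perL_of_pieces` / `w_rk4_of_pieces` (prover 2).  No converse is claimed.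
-/

noncomputable section

open scoped ComplexOrder

namespace HodgeCM

namespace Universe

namespace ThetaModel

variable {U : Universe} (T : U.ThetaModel) {Hk : U.HeckeData}

/-- Prover 1's transcription of Venkataramana's Theorem 8 implies prover 2's. -/
theorem virtualCup11_of_virtualCup (h : T.Fact_virtualCup Hk) : U.Fact_virtualCup11 := by
  intro L ι₁ hL V Γ ω η hω hη
  obtain ⟨Γ', hle, g, -, hne⟩ := h L ι₁ hL V Γ ω η hω hη
  exact ⟨Γ', T.cover Γ Γ' hle, g, hne⟩

/-- Hence prover 2's end-to-end theorems run on prover 1's fact: **PerL from the pieces (S), (P) of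
`RealisationReduction` and `Fact_virtualCup`.** -/
theorem perL_of_pieces_virtualCup (M : U.ModelAxioms) (h : T.Fact_virtualCup Hk) (hS : U.TypeSupplyPerL)
    (hP : U.PairingPerL) : U.PerL :=
  U.perL_of_pieces M (T.virtualCup11_of_virtualCup h) hS hP

/-- **`W^{RK4}` from the pieces of `RealisationReduction` and `Fact_virtualCup`.** -/
theorem w_rk4_of_pieces_virtualCup (M : U.ModelAxioms) (h : T.Fact_virtualCup Hk) (hS : U.TypeSupplyFace)
    (hP : U.PairingFace) : U.W_RK4 :=
  U.w_rk4_of_pieces M (T.virtualCup11_of_virtualCup h) hS hP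

end ThetaModel

end Universe

end HodgeCM

end
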